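import Literature.Claims.NS.Chishtie2025
import HarnessLib

/-!
# Solo salvage for claim C37 `Chishtie2025` (cell `ns-claims`, D-0090): the orthogonality (83) holds —
# in fact pointwise

Claim skeleton: `Literature/Claims/NS/Chishtie2025.lean` (typist `ns-claims-typist-6` g2; F. A. Chishtie,
arXiv:2505.22853 v3). Adjudicated #72: first failing step `Step1_Convection20` ((20) p.7), class false lemma
(`…Theorems.Chishtie2025.not_Step1_Convection20`). This file (seat `ns-claims-salvage-p3`) records the one
TRUE printed identity among the §5 steps that is not already in the skeleton:

* `chishtie2025_step3a_holds : Step3a_Orthogonality83` — (79)–(84) p.13–14: `∫ Re[(Q ⋆ ∇_Q Q) ⋆ Q̄] dx = 0`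
  for every smooth compactly supported divergence-free `u`. The integrand vanishes POINTWISE:
  `Re[(Q ⋆ A) ⋆ Q̄] = |Q|² Re A` for quaternions, and `Re(∇_Q Q) = −div u = 0` (`Q = u i + v j + w k`
  purely imaginary). No mathematics beyond the quaternion product rule (Lemma 5.1 = skeleton `step2_holds`).

Solo lane (`Theorems/SoloSalvage<Slug>.lean`, no item).

WHAT THIS IS NOT: not a claim about NS regularity or blow-up; not a claim about any author beyond the
typed locator.
-/

noncomputable section

-- The summit-side namespace repeats the summit name by design (D-0017 layout); tree precedent
-- `SoloSalvageLam2019.lean`.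
set_option linter.dupNamespace false

open MeasureTheory Set
open scoped ContDiff Quaternion RealInnerProductSpace

namespace Summit.NavierStokesRegularity.NavierStokesRegularity.Theorems.Chishtie2025Salvage

open Literature.Analysis.FluidPDE Literature.Analysis.FluidPDE.Tao2016 Literature.Claims.NS.Chishtie2025

/-- The integrand of (83) vanishes pointwise for a divergence-free `C¹` field:
`Re[(Q ⋆ ∇_Q Q) ⋆ Q̄](x) = 0`. -/
theorem re_convQ_mul_star_eq_zero {u : E3 → E3} (hu : ContDiff ℝ ∞ u) (hdiv : NSWave0.IsDivFree u)
    (x : E3) : ((Qf u x * nablaQ (Qf u) x) * star (Qf u x)).re = 0 := by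
  have hdx : HasFDerivAt u (fderiv ℝ u x) x := ((hu.differentiable (by simp)) x).hasFDerivAt
  have hpd : ∀ j, pd j (Qf u) x = quatOf (fderiv ℝ u x (e j)) := fun j => pd_Qf hdx j
  -- `div u (x) = Σ_j (Du(x) e_j)_j = 0`
  have hdiv' : fderiv ℝ u x (e 0) 0 + fderiv ℝ u x (e 1) 1 + fderiv ℝ u x (e 2) 2 = 0 := by
    have h := hdiv x
    change VectorCalculus.divergence u x = 0 at h
    rw [divergence_eq_sum_inner_fderiv (EuclideanSpace.basisFun (Fin 3) ℝ), Fin.sum_univ_three] at h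
    simpa [e, EuclideanSpace.basisFun_apply, EuclideanSpace.inner_single_left] using h
  rw [nablaQ, hpd 0, hpd 1, hpd 2]
  simp only [Qf, quatOf, qi, qj, qk, Quaternion.re_mul, Quaternion.imI_mul, Quaternion.imJ_mul,
    Quaternion.imK_mul, Quaternion.re_add, Quaternion.imI_add, Quaternion.imJ_add, Quaternion.imK_add,
    Quaternion.re_star, Quaternion.imI_star, Quaternion.imJ_star, Quaternion.imK_star]
  linear_combination (-(u x 0 ^ 2 + u x 1 ^ 2 + u x 2 ^ 2)) * hdiv'

/-- **Step 3a — (83) holds**: `Re⟨Q ⋆ ∇_Q Q, Q⟩_{L²} = ∫ Re[(Q ⋆ ∇_Q Q) ⋆ Q̄] dx = 0` for smooth compactly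
supported divergence-free `u` (the integrand is identically zero, `re_convQ_mul_star_eq_zero`). -/
theorem chishtie2025_step3a_holds : Literature.Claims.NS.Chishtie2025.Step3a_Orthogonality83 := by
  intro u hu _hc hdiv
  simp_rw [re_convQ_mul_star_eq_zero hu hdiv]
  exact integral_zero _ _

end Summit.NavierStokesRegularity.NavierStokesRegularity.Theorems.Chishtie2025Salvage

end
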